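import Literature.Analysis.FluidPDE.OnsagerBDSVPerturbationTildeR
import Literature.Analysis.FluidPDE.OnsagerBDSVGluedEnergy
import HarnessLib

/-!
# The BDSV perturbation: `∂ₜρ_q` (Lemma 5.4 (5.18)) and the normalised stress `R_{q,i}/ρ_{q,i}`

Buckmaster–De Lellis–Székelyhidi–Vicol (BDSV), *Onsager's conjecture for admissible weak
solutions*, CPAM 72 (2019) = arXiv:1701.08678, §5.2 and §5.5. Two scalar inputs of the
material-derivative estimate arXiv (5.38) of Prop. 5.9 (`‖D_{t,q}R̃_{q,i}‖_N ≲ τ_q^{-1}ℓ^{-N}`):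

* Lemma 5.4, arXiv (5.18): "`‖∂ₜρ_q‖₀ ≲ δ_{q+1} δ_q^{1/2} λ_q`", proved there from
  "`|d/dt ∫|v̄_q|² dx| = |2∫∇v̄_q · R̊̄_q dx| ≲ δ_{q+1}δ_q^{1/2}λ_q`" (the energy balance of the
  Euler–Reynolds system) for `ρ_q(t) = ⅓(e(t) - δ_{q+2}/2 - ∫|v̄_q|²)`;
* the normalised stress entering `R̃_{q,i}`, arXiv (5.27) (proof of Prop. 5.7): "Recalling
  property (iv) of `η_i` we see that `ρ_{q,i}` is a function of `t` only on `supp R̊̄_q`", whence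
  "`R_{q,i}/ρ_{q,i} = Id - (∑_j∫η_j²(y,t)dy / ρ_q(t)) R̊̄_q`".

For the honest objects of `OnsagerBDSVPerturbation.lean` this file PROVES:

* `BDSV.PerturbationData.etaMass_eq_one`: on the intervals `I_n = [t_n + τ_q/3, t_n + 2τ_q/3]`
  carrying `supp R̊̄_q` ((2.17)), `η_n ≡ 1` and the other cut-offs vanish ((ii), (iii)), so
  `∑_j∫η_j² = 1`; hence (`BDSV.PerturbationData.etaMass_div_rhoQ_smul_Rbar`) the coefficient of
  (5.27) simplifies on `[0,T]`: `(∑_j∫η_j²/ρ_q) R̊̄_q = ρ_q⁻¹ R̊̄_q`, and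
  `R̃_{q,i} = ∇Φ_i (Id - ρ_q⁻¹ R̊̄_q) ∇Φ_iᵀ` on `[0,T]` (`BDSV.PerturbationData.tildeR_eq`);
* `BDSV.PerturbationHypotheses.hasDerivWithinAt_rhoQ`: `ρ_q` is differentiable within `[0,T]`
  with `ρ_q' = ⅓(e' + 2∫∑ⱼ⟪R̊̄_q^{(j)}, ∂ⱼv̄_q⟫)` (the accepted energy balance
  `Torus.IsEulerReynoldsOn.hasDerivWithinAt_energy`), and the bound (5.18) in the explicit form
  `|ρ_q'| ≤ ⅓(1 + 6 (C_in δ_{q+1} ℓ^α)(C_in δ_q^{1/2} λ_q))` from `|e'| ≤ 1`, (2.19)|₀, (2.20)|₀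
  (`BDSV.PerturbationHypotheses.abs_rhoQDeriv_le`);
* the reciprocal `ρ_q⁻¹`: smooth on `[0,T]`, `|ρ_q⁻¹| ≤ 8λ_q^α/δ_{q+1}` and
  `|(ρ_q⁻¹)'| ≤ |ρ_q'| (8λ_q^α/δ_{q+1})²` under the lower bound (5.15)
  (`BDSV.PerturbationHypotheses.hasDerivWithinAt_inv_rhoQ`, `…abs_inv_rhoQ_le`,
  `…abs_invRhoQDeriv_le`).

## References

* T. Buckmaster, C. De Lellis, L. Székelyhidi Jr., V. Vicol, *Onsager's conjecture for admissible
  weak solutions*, Comm. Pure Appl. Math. 72 (2019) 229–274 = arXiv:1701.08678, §5.2 ((ii)–(iv),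
  `ρ_q`, `ρ_{q,i}`), Lemma 5.4 (arXiv (5.15), (5.18)) and its proof, §5.5 proof of Prop. 5.7
  (arXiv (5.27)), §2.5 (2.17), (2.19)–(2.20). Equation numbers as in arXiv:1701.08678v1.
-/

open MeasureTheory Set
open scoped NNReal ENNReal ContDiff Matrix Matrix.Norms.Elementwise InnerProductSpace

noncomputable section

namespace Literature.Analysis.FluidPDE

namespace BDSV

open FunctionSpaces FunctionSpaces.Torus

/-- The flat three-torus `T³ = (ℝ/ℤ)³`, local notation. -/
local notation "𝕋³" => UnitAddTorus (Fin 3)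

/-- Euclidean `ℝ³`, local notation. -/
local notation "ℝ³" => EuclideanSpace ℝ (Fin 3)

/-- Real `3 × 3` matrices, local notation. -/
local notation "𝕄" => Matrix (Fin 3) (Fin 3) ℝ

variable {P : Params} {S : Setting} {Nbar : ℕ} {Cin C₀ c₀ : ℝ} {Cη : ℕ → ℕ → ℝ}

/-! ## `∑_j ∫ η_j² = 1` on the support of the glued stress; the simplified `R̃_{q,i}` -/

section EtaMass

/-- `ofCols 0 = 0`. [folklore] -/
@[simp] theorem ofCols_zero : ofCols (0 : Fin 3 → ℝ³) = 0 := by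
  ext i j
  simp [ofCols]

/-- **`∑_j∫η_j² = 1` on the intervals `I_n`** (BDSV §5.2 (ii), (iii)): if `t ∈ [0,T]` lies in
`I_n = [t_n + τ_q/3, t_n + 2τ_q/3]`, `t_n = nτ_q`, then `η_n(t, ·) ≡ 1`, every other cut-off vanishes
at time `t`, and the normalising mass is `∫η_n² = 1`. [cite: BuckmasterEtAl2018, §5.2 (ii)–(iii)] -/
theorem PerturbationData.etaMass_eq_one (𝒟 : PerturbationData P S c₀ Cη) (ha : 1 ≤ P.a)
    {t : ℝ} (ht : t ∈ Icc 0 S.T) {n : ℕ}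
    (hn : t ∈ Icc ((n : ℝ) * P.τ S.q + P.τ S.q / 3) ((n : ℝ) * P.τ S.q + 2 * P.τ S.q / 3)) :
    etaMass P S 𝒟.cut.η t = 1 := by
  have hτ : 0 < P.τ S.q := glueScale_pos ha S.q
  have h1 : ∀ x, 𝒟.cut.η n t x = 1 := 𝒟.cut.eq_one n t ht hn
  have h0 : ∀ j, j ≠ n → ∀ x, 𝒟.cut.η j t x = 0 := by
    intro j hj x
    rcases 𝒟.cut.disjoint j n hj t x with h | h
    · exact h
    · exact absurd h (by rw [h1 x]; exact one_ne_zero)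
  -- `n` is one of the summed indices
  have hnT : (n : ℝ) * P.τ S.q ≤ S.T := by linarith [hn.1, ht.2]
  have hn_mem : n ∈ Finset.range (cutoffCount S.T (P.τ S.q)) := by
    rw [Finset.mem_range, cutoffCount]
    have h2 : (n : ℝ) ≤ S.T / P.τ S.q := by rw [le_div_iff₀ hτ]; exact hnT
    have h3 : n ≤ ⌈S.T / P.τ S.q⌉₊ := Nat.cast_le.1 (h2.trans (Nat.le_ceil _))
    omega
  unfold etaMass
  rw [Finset.sum_eq_single_of_mem n hn_mem fun j _ hj => by
    simp only [h0 j hj, zero_pow two_ne_zero, integral_zero]]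
  simp only [h1, one_pow]
  simp

/-- **The coefficient of (5.27) simplifies on `[0,T]`**: `(∑_j∫η_j²/ρ_q) R̊̄_q = ρ_q⁻¹ R̊̄_q`
pointwise on `[0,T] × T³` (on `supp R̊̄_q ⊂ ⋃ₙ Iₙ × T³`, (2.17), the mass is `1`; elsewhere both
sides vanish). [cite: BuckmasterEtAl2018, Prop. 5.7 (proof, arXiv (5.27))] -/
theorem PerturbationData.etaMass_div_rhoQ_smul_Rbar (H : PerturbationHypotheses P S Nbar Cin C₀)
    (𝒟 : PerturbationData P S c₀ Cη) (ha : 1 ≤ P.a) {t : ℝ} (ht : t ∈ Icc 0 S.T) (x : 𝕋³) :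
    (etaMass P S 𝒟.cut.η t / rhoQ P S t) • ofCols (S.Rbar t x) =
      (rhoQ P S t)⁻¹ • ofCols (S.Rbar t x) := by
  by_cases h : ∃ n : ℕ, t ∈ Icc ((n : ℝ) * P.τ S.q + P.τ S.q / 3) ((n : ℝ) * P.τ S.q + 2 * P.τ S.q / 3)
  · obtain ⟨n, hn⟩ := h
    rw [𝒟.etaMass_eq_one ha ht hn, one_div]
  · push Not at h
    have hR : S.Rbar t x = 0 := H.stress_support t ht h x
    rw [hR, ofCols_zero, smul_zero, smul_zero]

/-- **`R̃_{q,i}` on `[0,T]`**: `R̃_{q,i} = ∇Φ_i (Id - ρ_q⁻¹ R̊̄_q) ∇Φ_iᵀ` for `t ∈ [0,T]` (the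
(5.32)/(5.27) form with the mass normalised to `1`). [cite: BuckmasterEtAl2018, Prop. 5.7 (proof, arXiv (5.27))] -/
theorem PerturbationData.tildeR_eq (H : PerturbationHypotheses P S Nbar Cin C₀)
    (𝒟 : PerturbationData P S c₀ Cη) (ha : 1 ≤ P.a) (i : ℕ) {t : ℝ} (ht : t ∈ Icc 0 S.T) (x : 𝕋³) :
    tildeR P S 𝒟.cut.η 𝒟.D i t x =
      gradPhi 𝒟.D i t x * (1 - (rhoQ P S t)⁻¹ • ofCols (S.Rbar t x)) * (gradPhi 𝒟.D i t x)ᵀ := by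
  rw [tildeR, 𝒟.etaMass_div_rhoQ_smul_Rbar H ha ht x]

end EtaMass

/-! ## `∂ₜρ_q` (Lemma 5.4, arXiv (5.18)) -/

section RhoQ

/-- **`ρ_q` is differentiable within `[0,T]`** with
`ρ_q' = ⅓(e' - d/dt∫|v̄_q|²) = ⅓(e' + 2∫∑ⱼ⟪R̊̄_q^{(j)}, ∂ⱼv̄_q⟫)` (one-sided derivatives within
`[0,T]`; the energy balance of the Euler–Reynolds triple `(v̄_q, p̄_q, R̊̄_q)`).
[cite: BuckmasterEtAl2018, Lemma 5.4 (proof of arXiv (5.18))] -/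
theorem PerturbationHypotheses.hasDerivWithinAt_rhoQ (H : PerturbationHypotheses P S Nbar Cin C₀)
    {t : ℝ} (ht : t ∈ Icc 0 S.T) :
    HasDerivWithinAt (rhoQ P S)
      ((derivWithin S.e (Icc 0 S.T) t -
        (-2 * ∫ x, ∑ j, ⟪S.Rbar t x j, Torus.partialDeriv j (S.vbar t) x⟫_ℝ)) / 3) (Icc 0 S.T) t := by
  have he : HasDerivWithinAt S.e (derivWithin S.e (Icc 0 S.T) t) (Icc 0 S.T) t :=
    ((H.profile.smooth.differentiableOn (by simp)) t ht).hasDerivWithinAt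
  have hE := H.eulerReynolds.hasDerivWithinAt_energy H.pos_T ht
  have h := ((he.sub_const (amp P.β P.a P.b (S.q + 2) / 2)).sub hE).div_const 3
  have hfun : rhoQ P S = fun s =>
      (S.e s - amp P.β P.a P.b (S.q + 2) / 2 - ∫ x, ‖S.vbar s x‖ ^ 2) / 3 := by
    funext s
    rfl
  rw [hfun]
  exact h

/-- The derivative of `ρ_q` within `[0,T]`, as a name:
`ρ_q' = ⅓(e' + 2∫∑ⱼ⟪R̊̄_q^{(j)}, ∂ⱼv̄_q⟫)`. [cite: BuckmasterEtAl2018, Lemma 5.4 (arXiv (5.18))] -/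
def rhoQDeriv (S : Setting) (t : ℝ) : ℝ :=
  (derivWithin S.e (Icc 0 S.T) t -
    (-2 * ∫ x, ∑ j, ⟪S.Rbar t x j, Torus.partialDeriv j (S.vbar t) x⟫_ℝ)) / 3

/-- `derivWithin ρ_q [0,T] = rhoQDeriv` on `[0,T]`. [folklore] -/
theorem PerturbationHypotheses.derivWithin_rhoQ (H : PerturbationHypotheses P S Nbar Cin C₀)
    {t : ℝ} (ht : t ∈ Icc 0 S.T) :
    derivWithin (rhoQ P S) (Icc 0 S.T) t = rhoQDeriv S t :=
  (H.hasDerivWithinAt_rhoQ ht).derivWithin (uniqueDiffOn_Icc H.pos_T t ht)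

/-- **Lemma 5.4, arXiv (5.18), explicit form**: `|ρ_q'| ≤ ⅓(1 + 6 (C_in δ_{q+1} ℓ^α)(C_in δ_q^{1/2} λ_q))`
on `[0,T]`, from `|e'| ≤ 1` (2.1), `|R̊̄_q| ≤ C_in δ_{q+1} ℓ^α` ((2.20)|₀) and
`|∂ⱼv̄_q| ≤ C_in δ_q^{1/2}λ_q` ((2.19)|₀) (the source absorbs `|e'| ≤ 1 ≲ δ_{q+1}δ_q^{1/2}λ_q`,
valid for `b < (1-β)/(2β)` and `a` large). [cite: BuckmasterEtAl2018, Lemma 5.4 (arXiv (5.18))] -/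
theorem PerturbationHypotheses.abs_rhoQDeriv_le (H : PerturbationHypotheses P S Nbar Cin C₀)
    (hCin : 0 ≤ Cin) (ha : 1 ≤ P.a) {t : ℝ} (ht : t ∈ Icc 0 S.T) :
    |rhoQDeriv S t| ≤
      (1 + 6 * (Cin * (amp P.β P.a P.b (S.q + 1) * mollScale P.β P.α P.a P.b S.q ^ P.α)) *
        (Cin * (Real.sqrt (amp P.β P.a P.b S.q) * freq P.a P.b S.q))) / 3 := by
  set BR : ℝ := Cin * (amp P.β P.a P.b (S.q + 1) * mollScale P.β P.α P.a P.b S.q ^ P.α) with hBR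
  set Bv : ℝ := Cin * (Real.sqrt (amp P.β P.a P.b S.q) * freq P.a P.b S.q) with hBv
  have hBR0 : 0 ≤ BR :=
    mul_nonneg hCin (mul_nonneg (amp_pos ha _).le (Real.rpow_nonneg (mollScale_pos ha _).le _))
  have hBv0 : 0 ≤ Bv := mul_nonneg hCin (mul_nonneg (Real.sqrt_nonneg _) (freq_pos ha _).le)
  -- the pointwise inputs
  have hR : ∀ x (j : Fin 3), ‖S.Rbar t x j‖ ≤ BR := by
    intro x j
    have hRt := H.stress 0 (Nat.zero_le _) t ht
    simp only [Nat.cast_zero, neg_zero, zero_add] at hRt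
    exact (norm_le_pi_norm _ j).trans (norm_le_of_eContDiffHolderNorm_zero_le hBR0 hRt x)
  have hDv : ∀ x (j : Fin 3), ‖Torus.partialDeriv j (S.vbar t) x‖ ≤ Bv := by
    intro x j
    have hv := H.velocity 0 (Nat.zero_le _) t ht
    simp only [Nat.cast_zero, neg_zero, Real.rpow_zero, mul_one] at hv
    exact norm_partialDeriv_le_of_eContDiffHolderNorm_le
      ((H.eulerReynolds.smooth_velocity.isSmooth_slice ht).isContDiff (by simp)) hBv0 hv j x
  have hrate := Torus.abs_energyRate_le (v := S.vbar) (R := S.Rbar) (t := t) hBR0 hR hDv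
  rw [Fintype.card_fin] at hrate
  have he := H.profile.abs_deriv_le t ht
  unfold rhoQDeriv
  rw [abs_div, abs_of_pos (by norm_num : (0 : ℝ) < 3), div_le_div_iff_of_pos_right (by norm_num)]
  calc |derivWithin S.e (Icc 0 S.T) t -
          -2 * ∫ x, ∑ j, ⟪S.Rbar t x j, Torus.partialDeriv j (S.vbar t) x⟫_ℝ|
      ≤ |derivWithin S.e (Icc 0 S.T) t| +
          |(-2 : ℝ) * ∫ x, ∑ j, ⟪S.Rbar t x j, Torus.partialDeriv j (S.vbar t) x⟫_ℝ| := abs_sub _ _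
    _ ≤ 1 + 2 * (3 : ℕ) * BR * Bv := add_le_add he hrate
    _ = 1 + 6 * BR * Bv := by push_cast; ring

/-! ## The reciprocal `ρ_q⁻¹` -/

/-- `ρ_q > 0` on `[0,T]` under the lower bound (5.15), i.e. given `4δ_{q+2} ≤ δ_{q+1}λ_q^{-α}`
(a local variant of `PerturbationHypotheses.rhoQ_pos` of `OnsagerBDSVStressSplit.lean`, which assumes
`2δ_{q+2} ≤ δ_{q+1}λ_q^{-α}`; kept private to avoid that import). [cite: BuckmasterEtAl2018, Lemma 5.4 (arXiv (5.15))] -/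
private theorem PerturbationHypotheses.rhoQ_pos_of_four (H : PerturbationHypotheses P S Nbar Cin C₀)
    (ha : 1 ≤ P.a)
    (h4 : 4 * amp P.β P.a P.b (S.q + 2) ≤ amp P.β P.a P.b (S.q + 1) * freq P.a P.b S.q ^ (-P.α))
    {t : ℝ} (ht : t ∈ Icc 0 S.T) : 0 < rhoQ P S t := by
  have hpos : 0 < amp P.β P.a P.b (S.q + 1) * freq P.a P.b S.q ^ (-P.α) / 8 :=
    div_pos (mul_pos (amp_pos ha _) (Real.rpow_pos_of_pos (freq_pos ha _) _)) (by norm_num)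
  exact hpos.trans_le (H.le_rhoQ h4 ht)

/-- `ρ_q⁻¹` is smooth on `[0,T]` (where `ρ_q > 0`). [folklore] -/
theorem PerturbationHypotheses.contDiffOn_inv_rhoQ (H : PerturbationHypotheses P S Nbar Cin C₀)
    (ha : 1 ≤ P.a)
    (h4 : 4 * amp P.β P.a P.b (S.q + 2) ≤ amp P.β P.a P.b (S.q + 1) * freq P.a P.b S.q ^ (-P.α)) :
    ContDiffOn ℝ ∞ (fun t => (rhoQ P S t)⁻¹) (Icc 0 S.T) :=
  (contDiffOn_rhoQ H.pos_T H.profile.smooth H.eulerReynolds.smooth_velocity).inv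
    fun _ ht => (H.rhoQ_pos_of_four ha h4 ht).ne'

/-- **`|ρ_q⁻¹| ≤ 8λ_q^α/δ_{q+1}`** on `[0,T]` (from (5.15)). [cite: BuckmasterEtAl2018, Lemma 5.4 (arXiv (5.15))] -/
theorem PerturbationHypotheses.abs_inv_rhoQ_le (H : PerturbationHypotheses P S Nbar Cin C₀)
    (ha : 1 ≤ P.a)
    (h4 : 4 * amp P.β P.a P.b (S.q + 2) ≤ amp P.β P.a P.b (S.q + 1) * freq P.a P.b S.q ^ (-P.α))
    {t : ℝ} (ht : t ∈ Icc 0 S.T) :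
    |(rhoQ P S t)⁻¹| ≤ 8 * freq P.a P.b S.q ^ P.α / amp P.β P.a P.b (S.q + 1) := by
  have hf := freq_pos (b := P.b) ha S.q
  have hA := amp_pos (β := P.β) (b := P.b) ha (S.q + 1)
  have hρ := H.rhoQ_pos_of_four ha h4 ht
  have hlow := H.le_rhoQ h4 ht
  rw [abs_of_pos (inv_pos.2 hρ), inv_le_comm₀ hρ (by positivity)]
  calc (8 * freq P.a P.b S.q ^ P.α / amp P.β P.a P.b (S.q + 1))⁻¹
      = amp P.β P.a P.b (S.q + 1) * freq P.a P.b S.q ^ (-P.α) / 8 := by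
        rw [Real.rpow_neg hf.le]
        field_simp
    _ ≤ rhoQ P S t := hlow

/-- **`ρ_q⁻¹` is differentiable within `[0,T]`** with derivative `-ρ_q'/ρ_q²`. [folklore] -/
theorem PerturbationHypotheses.hasDerivWithinAt_inv_rhoQ (H : PerturbationHypotheses P S Nbar Cin C₀)
    (ha : 1 ≤ P.a)
    (h4 : 4 * amp P.β P.a P.b (S.q + 2) ≤ amp P.β P.a P.b (S.q + 1) * freq P.a P.b S.q ^ (-P.α))
    {t : ℝ} (ht : t ∈ Icc 0 S.T) :
    HasDerivWithinAt (fun s => (rhoQ P S s)⁻¹) (-rhoQDeriv S t / rhoQ P S t ^ 2) (Icc 0 S.T) t :=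
  (H.hasDerivWithinAt_rhoQ ht).inv (H.rhoQ_pos_of_four ha h4 ht).ne'

/-- **`|(ρ_q⁻¹)'| ≤ |ρ_q'| (8λ_q^α/δ_{q+1})²`** on `[0,T]`. [cite: BuckmasterEtAl2018, Prop. 5.9 (proof, arXiv (5.42))] -/
theorem PerturbationHypotheses.abs_invRhoQDeriv_le (H : PerturbationHypotheses P S Nbar Cin C₀)
    (ha : 1 ≤ P.a)
    (h4 : 4 * amp P.β P.a P.b (S.q + 2) ≤ amp P.β P.a P.b (S.q + 1) * freq P.a P.b S.q ^ (-P.α))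
    {t : ℝ} (ht : t ∈ Icc 0 S.T) :
    |(-rhoQDeriv S t / rhoQ P S t ^ 2)| ≤
      |rhoQDeriv S t| * (8 * freq P.a P.b S.q ^ P.α / amp P.β P.a P.b (S.q + 1)) ^ 2 := by
  have hρ := H.rhoQ_pos_of_four ha h4 ht
  have hinv := H.abs_inv_rhoQ_le ha h4 ht
  rw [abs_div, abs_neg, abs_of_pos (pow_pos hρ 2), div_eq_mul_inv, ← inv_pow]
  refine mul_le_mul_of_nonneg_left ?_ (abs_nonneg _)
  rw [abs_of_pos (inv_pos.2 hρ)] at hinv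
  exact pow_le_pow_left₀ (inv_pos.2 hρ).le hinv 2

end RhoQ

end BDSV

end Literature.Analysis.FluidPDE
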